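import Literature.Computability.Complexity.DeMorganSimulation
import HarnessLib

/-!
# Every Boolean function has a De Morgan circuit (proofs for `Circuit.lean`)

Discharges (D-0014) the named fact `exists_computes_deMorgan` of
`Literature/Computability/Complexity/Circuit.lean`: every Boolean function on a finite, nonempty
set of variables `ι` is computed by a straight-line circuit over the De Morgan basis
`deMorganBasis = {∧₂, ∨₂, ¬}`.

The printed argument (Jukna 2012, §1.1 "CNFs and DNFs": every `f` has a DNF, equivalently the
recurrence (1.1) `f(x₁,…,xₙ₊₁) = xₙ₊₁ ∧ f(x,1) ∨ ¬xₙ₊₁ ∧ f(x,0)`; §1.2: circuits over the basis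
`{∧, ∨, ¬}`; Arora–Barak 2009, Claim 2.13) is assembled from the tree:

* `cktSize_univ` (`CircuitComposition.lean`): Shannon expansion (1.1) gives a `B₂`-program for
  every `f` (its base case uses a constant gate, available in `B₂`);
* `CktSize.deMorgan_of_B2` (`DeMorganSimulation.lean`): a `B₂`-program on a set of variables
  containing `i₀` is simulated gate by gate over `{∧₂, ∨₂, ¬}`, the two constants being produced
  as `x_{i₀} ∨ ¬x_{i₀}`, `x_{i₀} ∧ ¬x_{i₀}` — this is exactly where `Nonempty ι` is needed
  (`deMorganBasis` has no constant gates, and over `ι = ∅` no De Morgan circuit exists at all);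
* `CktSize.toCircuit` packages the single-output program as a `Circuit ι`.

We also record the quantitative form (size `≤ 12 · univBound |ι| + 3`) and the consequence that
the infimum defining `circuitSizeOver deMorganBasis f` is attained (review F13c of `Circuit.lean`).

This file lives beside `Circuit.lean` rather than in it because the proof uses
`CircuitComposition.lean` / `DeMorganSimulation.lean`, which import `Circuit.lean`.

## References

* S. Jukna, *Boolean Function Complexity: Advances and Frontiers*, Springer 2012
  (Algorithms and Combinatorics 27), §1.1 (CNFs and DNFs, Eq. (1.1)), §1.2 (circuits over a
  basis; De Morgan circuits) [Jukna2012].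
* S. Arora, B. Barak, *Computational Complexity: A Modern Approach*, CUP 2009, Claim 2.13
  [AroraBarakCC2009].
-/

namespace Literature.Computability.Complexity

/-- **Every Boolean function has a `{∧₂, ∨₂, ¬}`-circuit, with a size bound**: for a finite set of
variables `ι` containing `i₀` and any `f : (ι → Bool) → Bool` there is a circuit over
`deMorganBasis` computing `f` with at most `12 · univBound |ι| + 3` gates (Shannon expansion
over `B₂`, then the constant-factor simulation of `B₂` by the De Morgan basis)
(Jukna 2012, §1.1 Eq. (1.1) and §1.2; Arora–Barak 2009, Claim 2.13). [cite: Jukna2012, §1.1 Eq. (1.1) and §1.2] -/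
theorem exists_computes_deMorgan_size_le {ι : Type*} [Fintype ι] (i₀ : ι)
    (f : (ι → Bool) → Bool) :
    ∃ C : Circuit ι, C.IsOver deMorganBasis ∧ C.Computes f ∧
      C.size ≤ 12 * univBound (Fintype.card ι) + 3 := by
  obtain ⟨C, hB, hs, hev⟩ :=
    ((cktSize_univ (ι := ι) fun x (_ : Unit) => f x).deMorgan_of_B2 i₀).toCircuit
  exact ⟨C, hB, fun x => hev x, hs⟩

/-- **Discharge of `exists_computes_deMorgan`** (`Circuit.lean`): every Boolean function on
finitely many (and at least one) variables is computed by a circuit over the De Morgan basis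
`{∧₂, ∨₂, ¬}` (Jukna 2012, §1.1 "CNFs and DNFs", Eq. (1.1), and §1.2; Arora–Barak 2009,
Claim 2.13). [cite: Jukna2012, §1.1 Eq. (1.1) and §1.2] -/
theorem exists_computes_deMorgan_holds : exists_computes_deMorgan := by
  intro ι _ _ f
  obtain ⟨i₀⟩ := ‹Nonempty ι›
  obtain ⟨C, hB, hf, -⟩ := exists_computes_deMorgan_size_le i₀ f
  exact ⟨C, hB, hf⟩

/-- Over the De Morgan basis on a finite nonempty set of variables the infimum defining
`circuitSizeOver deMorganBasis f` is attained: some `{∧₂, ∨₂, ¬}`-circuit computing `f` has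
exactly `circuitSizeOver deMorganBasis f` gates (so the value is never the junk `0` of an empty
infimum) (Vollmer 1999, Def. 1.7; Jukna 2012, §1.2). [cite: Jukna2012, §1.2] -/
theorem exists_circuit_size_eq_circuitSizeOver_deMorgan {ι : Type*} [Fintype ι] [Nonempty ι]
    (f : (ι → Bool) → Bool) :
    ∃ C : Circuit ι, C.IsOver deMorganBasis ∧ C.Computes f ∧
      C.size = circuitSizeOver deMorganBasis f := by
  obtain ⟨C, hB, hf⟩ := exists_computes_deMorgan_holds f
  have hne : {s | ∃ C : Circuit ι, C.IsOver deMorganBasis ∧ C.Computes f ∧ C.size = s}.Nonempty :=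
    ⟨C.size, C, hB, hf, rfl⟩
  obtain ⟨C', hB', hf', hs⟩ := Nat.sInf_mem hne
  exact ⟨C', hB', hf', hs⟩

/-- Consequently any `{∧₂, ∨₂, ¬}`-circuit computing `f` has at least
`circuitSizeOver deMorganBasis f` gates **and** that bound is realised; in particular
`circuitSizeOver deMorganBasis f ≤ 12 · univBound |ι| + 3` (Jukna 2012, §1.2). [cite: Jukna2012, §1.2] -/
theorem circuitSizeOver_deMorgan_le {ι : Type*} [Fintype ι] [Nonempty ι]
    (f : (ι → Bool) → Bool) :
    circuitSizeOver deMorganBasis f ≤ 12 * univBound (Fintype.card ι) + 3 := by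
  obtain ⟨i₀⟩ := ‹Nonempty ι›
  obtain ⟨C, hB, hf, hs⟩ := exists_computes_deMorgan_size_le i₀ f
  exact (circuitSizeOver_le_of_computes C hB hf).trans hs

end Literature.Computability.Complexity
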